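import Summits.HodgeConjecture.CorCM.IrreducibleOddWeightsIndexParityShadowPair
import Mathlib.RepresentationTheory.Irreducible
import HarnessLib

/-!
# Row spaces over the commutant, I: rank-one matrix coefficients of an IRREDUCIBLE representation SEPARATE OVER THE
# COMMUTANT — `φ(g·v) = ψ(g·w) ∀g ⟹ v = 0 ∨ φ = ψ ∘ d` for an intertwining operator `d`

COR-CM (cell `pub-hodgecm2`, binder seat `b16` gen 69, count-neutral claim ROW SPACES OVER THE COMMUTANT, file Q1 —
abstract representation level; theorems only, no definition, no named fact, no `sorry`).  NEW as stated, hence under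
`Summits/`.  HONEST FRAMING: elementary linear algebra of a (possibly infinite) group acting linearly on `ℚ`-vector
spaces (the graph ∕ density argument behind Burnside–Jacobson), written for Mathlib's `Representation.IsIrreducible`; it
discharges — for EVERY irreducible `V` — the separation hypothesis `hsep` of gen 68's rank-one models (P5
`IrreducibleOddWeightsIndexParityShadowPair` §3, where it was verified by hand for the D₄ plane) with the commutant in
place of `ℚ`; `HC_CM` is neither used nor asserted.

SETTING.  `π : Representation ℚ G V`, `σ : Representation ℚ G W`; the ORBIT MAP of `v ∈ V` is
`T_v : (G →₀ ℚ) → V`, `x ↦ Σ_g x(g)·(π g v)` (`Finsupp.linearCombination ℚ (g ↦ π g v)`) — the action of the group algebra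
on `v` without naming the group algebra.

* §1 Orbit maps: `T_v(h·x) = π h (T_v x)` (`linearCombination_mapDomain_mul`); the range of `T_v` is `π`-stable, hence
  ALL of `V` when `π` is irreducible and `v ≠ 0` (`range_linearCombination_eq_top`); a functional vanishing on an orbit
  vanishes (`dual_eq_zero_of_forall_apply_eq_zero`).
* §2 **DENSITY FOR TWO VECTORS** (`exists_intertwiningMap_apply_eq`): `π` irreducible, `v ≠ 0`, `w ∈ W` arbitrary; if
  every relation `Σ x(g) π g v = 0` also kills `w` (`Σ x(g) σ g w = 0`) then `w = d v` for an INTERTWINING map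
  `d : V → W` (the graph of `d` is the orbit of `(v, w)`; no complement ∕ Maschke is used, `G` need not be finite).
* §3 **SEPARATION OVER THE COMMUTANT** (`separate_of_isIrreducible`): `π, σ` irreducible, `φ ∈ V*`, `ψ ∈ W*`:
  **`φ(π g v) = ψ(σ g w)` for all `g` ⟹ `v = 0` or `φ = ψ ∘ d` for an intertwining `d : V → W`** (possibly `d = 0`,
  i.e. `φ = 0`).  Same representation, all intertwiners scalar (ABSOLUTE irreducibility) ⟹ gen 68's `hsep` verbatim
  (`separate_of_isIrreducible_of_forall_smul`): `v = 0 ∨ ∃ t, φ = t • ψ`.  NON-ISOMORPHIC irreducibles (no non-zero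
  intertwiner) ⟹ a common rank-one coefficient is ZERO (`coeff_eq_zero_of_forall_intertwiningMap_eq_zero`).
* §4 Consequence for gen 68's rank-one models: **`span_inf_span_eq_bot_of_forall_intertwiningMap_ne`** — if
  `φ₀ ≠ φ₁ ∘ d` for EVERY intertwining `d` then `span{g ↦ φ₀(π g v)} ∩ span{g ↦ φ₁(π g v′)} = 0`, and the pair of slots
  is ADDITIVE (`typeRank_sigmaType_add_card_eq_of_forall_intertwiningMap_ne`: `rank(Φ₀,Φ₁) + 2 = rank Φ₀ + rank Φ₁ + 1`)
  — P5's `…_of_moment_not_parallel` with absolute irreducibility REMOVED: the moments must be non-proportional OVER THE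
  COMMUTANT `End_G(V)` (a division algebra), not merely over `ℚ`.

## References

* [Lang2002] S. Lang, *Algebra*, 3rd ed., XVII §3 (density; Burnside's theorem), XVII §1 Prop. 1.1 (Schur).
* [Serre1977] J.-P. Serre, *Linear Representations of Finite Groups*, GTM 42, §2.2 (Schur's lemma, matrix coefficients).
* [CurtisReiner1962] C. W. Curtis, I. Reiner, *Representation Theory of Finite Groups and Associative Algebras*, §27
  (Burnside's theorem and the density theorem), (27.8).
* [Gordon1999HodgeAVSurvey] B. B. Gordon, *A survey of the Hodge conjecture for abelian varieties*, §3 Theorem, 7.5–7.7.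
-/

set_option autoImplicit false

noncomputable section

open scoped BigOperators Classical

universe u v v' v'' v''' w

namespace Summit.HodgeConjecture.CorCM.IrrOdd

open Literature.NumberTheory.ComplexMultiplication

variable {G : Type w} [Group G] {V : Type v} [AddCommGroup V] [Module ℚ V] {W : Type v'} [AddCommGroup W] [Module ℚ W]

/-! ### §1 Orbit maps -/

/-- The orbit map intertwines left translation of coefficients with the action: `T_v(h·x) = π h (T_v x)`.
[cite: Serre1977, §2.2] -/
theorem linearCombination_mapDomain_mul (π : Representation ℚ G V) (v : V) (h : G) (x : G →₀ ℚ) :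
    Finsupp.linearCombination ℚ (fun g : G => π g v) (Finsupp.mapDomain (h * ·) x) =
      π h (Finsupp.linearCombination ℚ (fun g : G => π g v) x) := by
  rw [Finsupp.linearCombination_mapDomain, Finsupp.apply_linearCombination]
  congr 2
  funext g
  simp [map_mul]

/-- The range of the orbit map is stable under the action. [cite: Serre1977, §2.2] -/
theorem apply_mem_range_linearCombination (π : Representation ℚ G V) (v : V) (h : G) {u : V}
    (hu : u ∈ LinearMap.range (Finsupp.linearCombination ℚ (fun g : G => π g v))) :
    π h u ∈ LinearMap.range (Finsupp.linearCombination ℚ (fun g : G => π g v)) := by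
  obtain ⟨x, rfl⟩ := hu
  exact ⟨Finsupp.mapDomain (h * ·) x, linearCombination_mapDomain_mul π v h x⟩

/-- Irreducibility in elementary form: a stable subspace is `⊥` or `⊤`. [cite: Serre1977, §1.3] -/
theorem eq_bot_or_eq_top_of_isIrreducible (π : Representation ℚ G V) [π.IsIrreducible] (N : Submodule ℚ V)
    (hN : ∀ (g : G) (u : V), u ∈ N → π g u ∈ N) : N = ⊥ ∨ N = ⊤ := by
  rcases IsSimpleOrder.eq_bot_or_eq_top (⟨N, fun g u hu => hN g u hu⟩ : Subrepresentation π) with h | h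
  · exact Or.inl (congrArg Subrepresentation.toSubmodule h)
  · exact Or.inr (congrArg Subrepresentation.toSubmodule h)

/-- **The orbit of a non-zero vector of an irreducible representation spans**: the orbit map is onto.
[cite: Serre1977, §1.3 and §2.2] -/
theorem range_linearCombination_eq_top (π : Representation ℚ G V) [π.IsIrreducible] {v : V} (hv : v ≠ 0) :
    LinearMap.range (Finsupp.linearCombination ℚ (fun g : G => π g v)) = ⊤ := by
  rcases eq_bot_or_eq_top_of_isIrreducible π _ (fun g u hu => apply_mem_range_linearCombination π v g hu) with h | h
  · exfalso
    apply hv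
    have hmem : v ∈ LinearMap.range (Finsupp.linearCombination ℚ (fun g : G => π g v)) :=
      ⟨Finsupp.single 1 1, by simp⟩
    rw [h] at hmem
    exact (Submodule.mem_bot ℚ).1 hmem
  · exact h

/-- A functional vanishing on the orbit of a non-zero vector of an irreducible representation is zero.
[cite: Serre1977, §2.2] -/
theorem dual_eq_zero_of_forall_apply_eq_zero (π : Representation ℚ G V) [π.IsIrreducible] {v : V} (hv : v ≠ 0)
    (φ : Module.Dual ℚ V) (hφ : ∀ g : G, φ (π g v) = 0) : φ = 0 := by
  have hker : LinearMap.range (Finsupp.linearCombination ℚ (fun g : G => π g v)) ≤ LinearMap.ker φ := by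
    rintro _ ⟨x, rfl⟩
    rw [LinearMap.mem_ker, Finsupp.apply_linearCombination]
    have h0 : (⇑φ ∘ fun g : G => π g v) = 0 := funext fun g => hφ g
    rw [h0, Finsupp.linearCombination_zero, LinearMap.zero_apply]
  rw [range_linearCombination_eq_top π hv, top_le_iff, LinearMap.ker_eq_top] at hker
  exact hker

/-- Linear extension of a rank-one coefficient identity from group elements to the group algebra:
`φ(T_v x) = ψ(T_w x)` for every finitely supported `x`. [cite: Serre1977, §2.2] -/
theorem apply_linearCombination_eq_of_forall (π : Representation ℚ G V) (σ : Representation ℚ G W)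
    {φ : Module.Dual ℚ V} {ψ : Module.Dual ℚ W} {v : V} {w : W} (h : ∀ g : G, φ (π g v) = ψ (σ g w))
    (x : G →₀ ℚ) :
    φ (Finsupp.linearCombination ℚ (fun g : G => π g v) x) =
      ψ (Finsupp.linearCombination ℚ (fun g : G => σ g w) x) := by
  have hcomp : φ ∘ₗ Finsupp.linearCombination ℚ (fun g : G => π g v) =
      ψ ∘ₗ Finsupp.linearCombination ℚ (fun g : G => σ g w) := by
    apply Finsupp.lhom_ext'
    intro g
    apply LinearMap.ext_ring
    simp [h g]
  exact LinearMap.congr_fun hcomp x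

/-! ### §2 Density for two vectors: the graph argument -/

/-- Over a field, a linear map vanishing on `ker f` factors through `f`. [folklore] -/
theorem exists_comp_eq_of_ker_le {U : Type v''} [AddCommGroup U] [Module ℚ U] (f : U →ₗ[ℚ] V) (f' : U →ₗ[ℚ] W)
    (h : LinearMap.ker f ≤ LinearMap.ker f') : ∃ d : V →ₗ[ℚ] W, d ∘ₗ f = f' := by
  obtain ⟨d, hd⟩ := LinearMap.exists_extend
    (((LinearMap.ker f).liftQ f' h) ∘ₗ (f.quotKerEquivRange.symm : LinearMap.range f →ₗ[ℚ] U ⧸ LinearMap.ker f))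
  refine ⟨d, LinearMap.ext fun u => ?_⟩
  have hu := LinearMap.congr_fun hd ⟨f u, LinearMap.mem_range_self f u⟩
  simp only [LinearMap.coe_comp, Function.comp_apply, Submodule.coe_subtype, LinearEquiv.coe_coe,
    LinearMap.quotKerEquivRange_symm_apply_image, Submodule.mkQ_apply, Submodule.liftQ_apply] at hu
  simpa using hu

/-- **DENSITY FOR TWO VECTORS.**  Let `π` be irreducible, `v ≠ 0`, and let `σ` be any representation on `W`, `w ∈ W`.
If every linear relation among the translates of `v` holds among those of `w`
(`Σ x(g) π g v = 0 ⟹ Σ x(g) σ g w = 0`), then `w = d v` for an INTERTWINING operator `d : V → W` — the orbit of `(v, w)`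
spans the graph of `d`.  Contrapositive: if `w ∉ Hom_G(V, W)·v` there is a group-algebra element killing `v` but not `w`.
[cite: Lang2002, XVII §3] [cite: CurtisReiner1962, §27] -/
theorem exists_intertwiningMap_apply_eq (π : Representation ℚ G V) [π.IsIrreducible] (σ : Representation ℚ G W)
    {v : V} (hv : v ≠ 0) (w : W)
    (h : ∀ x : G →₀ ℚ, Finsupp.linearCombination ℚ (fun g : G => π g v) x = 0 →
      Finsupp.linearCombination ℚ (fun g : G => σ g w) x = 0) :
    ∃ d : π.IntertwiningMap σ, d v = w := by
  obtain ⟨d, hd⟩ := exists_comp_eq_of_ker_le (Finsupp.linearCombination ℚ (fun g : G => π g v))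
    (Finsupp.linearCombination ℚ (fun g : G => σ g w)) (fun x hx => by
      rw [LinearMap.mem_ker] at hx ⊢
      exact h x hx)
  have hsurj := range_linearCombination_eq_top π hv
  refine ⟨LinearMap.intertwiningMap_of_isIntertwiningMap π σ d (fun g u => ?_), ?_⟩
  · obtain ⟨x, rfl⟩ : u ∈ LinearMap.range (Finsupp.linearCombination ℚ (fun g : G => π g v)) := by
      rw [hsurj]; exact Submodule.mem_top
    calc d (π g (Finsupp.linearCombination ℚ (fun g : G => π g v) x))
        = d (Finsupp.linearCombination ℚ (fun g : G => π g v) (Finsupp.mapDomain (g * ·) x)) := by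
          rw [linearCombination_mapDomain_mul]
      _ = Finsupp.linearCombination ℚ (fun g : G => σ g w) (Finsupp.mapDomain (g * ·) x) :=
          LinearMap.congr_fun hd _
      _ = σ g (Finsupp.linearCombination ℚ (fun g : G => σ g w) x) := linearCombination_mapDomain_mul σ w g x
      _ = σ g (d (Finsupp.linearCombination ℚ (fun g : G => π g v) x)) := by rw [← LinearMap.congr_fun hd x]; rfl
  · have h1 := LinearMap.congr_fun hd (Finsupp.single 1 1)
    simp only [LinearMap.coe_comp, Function.comp_apply, Finsupp.linearCombination_single, map_one, one_smul,
      Module.End.one_apply] at h1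
    simpa using h1

/-! ### §3 Separation over the commutant -/

/-- **SEPARATION OVER THE COMMUTANT.**  `π` on `V` and `σ` on `W` irreducible, `φ ∈ V*`, `ψ ∈ W*`, `v ∈ V`, `w ∈ W`:
if the rank-one matrix coefficients agree, `φ(π g v) = ψ(σ g w)` for every `g`, then `v = 0` or `φ = ψ ∘ d` for an
intertwining operator `d : V → W` (with `d v = w` when `φ ≠ 0`; `d = 0` exactly when `φ = 0`).  For `W = V` absolutely
irreducible this is the separation of rank-one tensors by matrix coefficients (Burnside); in general the row is
determined up to the COMMUTANT. [cite: Lang2002, XVII §3] [cite: Serre1977, §2.2] [cite: CurtisReiner1962, §27] -/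
theorem separate_of_isIrreducible (π : Representation ℚ G V) [π.IsIrreducible] (σ : Representation ℚ G W)
    [σ.IsIrreducible] (φ : Module.Dual ℚ V) (ψ : Module.Dual ℚ W) (v : V) (w : W)
    (h : ∀ g : G, φ (π g v) = ψ (σ g w)) :
    v = 0 ∨ ∃ d : π.IntertwiningMap σ, φ = ψ ∘ₗ d.toLinearMap := by
  by_cases hv : v = 0
  · exact Or.inl hv
  right
  have hlin := apply_linearCombination_eq_of_forall π σ h
  by_cases hker : ∀ x : G →₀ ℚ, Finsupp.linearCombination ℚ (fun g : G => π g v) x = 0 →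
      Finsupp.linearCombination ℚ (fun g : G => σ g w) x = 0
  · -- the graph case: `w = d v`, and `φ − ψ ∘ d` kills the orbit of `v`
    obtain ⟨d, hdv⟩ := exists_intertwiningMap_apply_eq π σ hv w hker
    refine ⟨d, ?_⟩
    have hzero := dual_eq_zero_of_forall_apply_eq_zero π hv (φ - ψ ∘ₗ d.toLinearMap) fun g => by
      rw [LinearMap.sub_apply, LinearMap.comp_apply, h g, ← hdv, sub_eq_zero]
      exact congrArg ψ (Representation.IntertwiningMap.isIntertwining π σ d g v).symm
    exact sub_eq_zero.1 hzero
  · -- the density case: some group-algebra element kills `v` but not `w`; then `ψ = 0` and `φ = 0`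
    push Not at hker
    obtain ⟨x, hx0, hx1⟩ := hker
    have hψ : ψ = 0 := dual_eq_zero_of_forall_apply_eq_zero σ hx1 ψ fun g => by
      rw [← linearCombination_mapDomain_mul σ w g x, ← hlin, linearCombination_mapDomain_mul π v g x, hx0, map_zero,
        map_zero]
    have hφ : φ = 0 := dual_eq_zero_of_forall_apply_eq_zero π hv φ fun g => by rw [h g, hψ, LinearMap.zero_apply]
    exact ⟨0, by rw [hφ, hψ, LinearMap.zero_comp]⟩

/-- With `d v = w` made explicit: under the same hypotheses and `φ ≠ 0`, `v = 0` or there is an intertwining `d` with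
`φ = ψ ∘ d` AND `d v = w`. [cite: Lang2002, XVII §3] [cite: CurtisReiner1962, §27] -/
theorem separate_of_isIrreducible_apply (π : Representation ℚ G V) [π.IsIrreducible] (σ : Representation ℚ G W)
    [σ.IsIrreducible] {φ : Module.Dual ℚ V} (hφ : φ ≠ 0) (ψ : Module.Dual ℚ W) (v : V) (w : W)
    (h : ∀ g : G, φ (π g v) = ψ (σ g w)) :
    v = 0 ∨ ∃ d : π.IntertwiningMap σ, φ = ψ ∘ₗ d.toLinearMap ∧ d v = w := by
  by_cases hv : v = 0
  · exact Or.inl hv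
  right
  have hlin := apply_linearCombination_eq_of_forall π σ h
  by_cases hker : ∀ x : G →₀ ℚ, Finsupp.linearCombination ℚ (fun g : G => π g v) x = 0 →
      Finsupp.linearCombination ℚ (fun g : G => σ g w) x = 0
  · obtain ⟨d, hdv⟩ := exists_intertwiningMap_apply_eq π σ hv w hker
    refine ⟨d, ?_, hdv⟩
    have hzero := dual_eq_zero_of_forall_apply_eq_zero π hv (φ - ψ ∘ₗ d.toLinearMap) fun g => by
      rw [LinearMap.sub_apply, LinearMap.comp_apply, h g, ← hdv, sub_eq_zero]
      exact congrArg ψ (Representation.IntertwiningMap.isIntertwining π σ d g v).symm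
    exact sub_eq_zero.1 hzero
  · exfalso
    push Not at hker
    obtain ⟨x, hx0, hx1⟩ := hker
    have hψ : ψ = 0 := dual_eq_zero_of_forall_apply_eq_zero σ hx1 ψ fun g => by
      rw [← linearCombination_mapDomain_mul σ w g x, ← hlin, linearCombination_mapDomain_mul π v g x, hx0, map_zero,
        map_zero]
    exact hφ (dual_eq_zero_of_forall_apply_eq_zero π hv φ fun g => by rw [h g, hψ, LinearMap.zero_apply])

/-- **ABSOLUTELY IRREDUCIBLE ⟹ gen 68's `hsep`**: if every intertwining operator of `π` is a scalar, rank-one matrix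
coefficients separate rank-one tensors over `ℚ`: `φ(π g v) = φ′(π g v′) ∀ g ⟹ v = 0 ∨ φ ∈ ℚφ′` — the hypothesis of
P5 `span_inf_span_eq_bot_of_not_parallel` / `typeRank_sigmaType_add_card_eq_of_moment_not_parallel`, discharged for
every absolutely irreducible `V` (P5 `separate_of_dihedral` is the D₄ plane). [cite: Lang2002, XVII §3] -/
theorem separate_of_isIrreducible_of_forall_smul (π : Representation ℚ G V) [π.IsIrreducible]
    (habs : ∀ d : π.IntertwiningMap π, ∃ t : ℚ, d.toLinearMap = t • LinearMap.id)
    (φ φ' : Module.Dual ℚ V) (v v' : V) (h : ∀ g : G, φ (π g v) = φ' (π g v')) :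
    v = 0 ∨ ∃ t : ℚ, φ = t • φ' := by
  rcases separate_of_isIrreducible π π φ φ' v v' h with hv | ⟨d, hd⟩
  · exact Or.inl hv
  · obtain ⟨t, ht⟩ := habs d
    refine Or.inr ⟨t, ?_⟩
    rw [hd, ht, LinearMap.comp_smul, LinearMap.comp_id]

/-- **NON-ISOMORPHIC IRREDUCIBLES HAVE INDEPENDENT RANK-ONE COEFFICIENTS**: if the only intertwining operator `V → W`
is zero (e.g. `π ≇ σ`, Schur), a common rank-one coefficient `g ↦ φ(π g v) = ψ(σ g w)` is identically zero.
[cite: Serre1977, §2.2] [cite: Lang2002, XVII §1 Prop. 1.1] -/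
theorem coeff_eq_zero_of_forall_intertwiningMap_eq_zero (π : Representation ℚ G V) [π.IsIrreducible]
    (σ : Representation ℚ G W) [σ.IsIrreducible] (hzero : ∀ d : π.IntertwiningMap σ, d = 0)
    (φ : Module.Dual ℚ V) (ψ : Module.Dual ℚ W) (v : V) (w : W) (h : ∀ g : G, φ (π g v) = ψ (σ g w)) :
    (fun g : G => φ (π g v)) = 0 := by
  rcases separate_of_isIrreducible π σ φ ψ v w h with hv | ⟨d, hd⟩
  · funext g; simp [hv]
  · funext g
    rw [hd, hzero d, Representation.IntertwiningMap.zero_toLinearMap, LinearMap.comp_zero]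
    rfl

/-! ### §4 Rank-one models over the commutant: non-related rows give disjoint coefficient spaces -/

/-- **ROWS NOT RELATED BY THE COMMUTANT GIVE DISJOINT COEFFICIENT SPACES.**  `π` irreducible; if `φ₀ ≠ φ₁ ∘ d` for
every intertwining operator `d` of `π` (the moments are NOT PROPORTIONAL OVER THE COMMUTANT), then
`span{g ↦ φ₀(π g v) : v ∈ S₀} ∩ span{g ↦ φ₁(π g v) : v ∈ S₁} = 0`.  P5 `span_inf_span_eq_bot_of_not_parallel` is the
absolutely irreducible case. [cite: Lang2002, XVII §3] [cite: Serre1977, §2.2] -/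
theorem span_inf_span_eq_bot_of_forall_intertwiningMap_ne (π : Representation ℚ G V) [π.IsIrreducible]
    {φ₀ φ₁ : Module.Dual ℚ V} (hne : ∀ d : π.IntertwiningMap π, φ₀ ≠ φ₁ ∘ₗ d.toLinearMap) (S₀ S₁ : Set V) :
    Submodule.span ℚ ((fun v : V => fun g : G => φ₀ (π g v)) '' S₀) ⊓
        Submodule.span ℚ ((fun v : V => fun g : G => φ₁ (π g v)) '' S₁) = ⊥ := by
  rw [Submodule.eq_bot_iff]
  rintro c ⟨hc₀, hc₁⟩
  obtain ⟨v, rfl⟩ := exists_eq_coeff_of_mem_span π φ₀ hc₀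
  obtain ⟨v', hv'⟩ := exists_eq_coeff_of_mem_span π φ₁ hc₁
  rcases separate_of_isIrreducible π π φ₀ φ₁ v v' (fun g => congrFun hv' g) with hv | ⟨d, hd⟩
  · funext g
    simp [hv]
  · exact absurd hd (hne d)

variable {I : Type u} {E : I → Type v'''} [∀ i, MulAction G (E i)] [∀ i, Fintype (E i)] [Fintype I]
  [∀ i, Nonempty (E i)] {Y₀ : Type v'} [DecidableEq Y₀] [MulAction G Y₀] {Y₁ : Type v''} [DecidableEq Y₁]
  [MulAction G Y₁]

/-- **POSITIONAL ADDITIVITY OVER THE COMMUTANT.**  In a rank-one model of gen 68 (shadow translates of both slots are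
matrix coefficients `g ↦ φ_κ(π g (e_κ y))` of ONE representation `π`), irreducibility of `π` and
`φ₀ ≠ φ₁ ∘ d` for every intertwining `d` give `rank(Φ₀,Φ₁) + 2 = rank Φ₀ + rank Φ₁ + 1`: the pair is ADDITIVE although
both slots see the constituent `V`.  This is P5 `typeRank_sigmaType_add_card_eq_of_moment_not_parallel` with the
hypothesis «coefficients separate rank-one tensors» REPLACED by irreducibility and «not parallel over `ℚ`» by «not
related by the commutant». [cite: Gordon1999HodgeAVSurvey, §3 Theorem, 7.5–7.7] [cite: Lang2002, XVII §3] -/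
theorem typeRank_sigmaType_add_card_eq_of_forall_intertwiningMap_ne {ρ : G} {Φ : ∀ i, Set (E i)}
    (h : ∀ i, IsCMTypeWith ρ (Φ i)) {i₀ i₁ : I} (hI : ∀ j, j = i₀ ∨ j = i₁) (h01 : i₀ ≠ i₁)
    (r₀ : E i₀ → Y₀) (r₁ : E i₁ → Y₁) (hr₀ : ∀ (g : G) (x : E i₀), r₀ (g • x) = g • r₀ x)
    (hr₁ : ∀ (g : G) (x : E i₁), r₁ (g • x) = g • r₁ x)
    (hfine₀ : ∀ x x' : E i₀, r₀ x = r₀ x' → ∃ n : G, (∀ y : E i₁, n • y = y) ∧ n • x = x')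
    (hfine₁ : ∀ x x' : E i₁, r₁ x = r₁ x' → ∃ n : G, (∀ y : E i₀, n • y = y) ∧ n • x = x')
    (π : Representation ℚ G V) [π.IsIrreducible] {φ₀ φ₁ : Module.Dual ℚ V}
    (hne : ∀ d : π.IntertwiningMap π, φ₀ ≠ φ₁ ∘ₗ d.toLinearMap) (e₀ : Y₀ → V) (e₁ : Y₁ → V)
    (hw₀ : ∀ (y : Y₀) (g : G), ∑ x ∈ Finset.univ.filter (fun x => r₀ x = g • y), antiVec (Φ i₀) (1 : G) x =
      φ₀ (π g (e₀ y)))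
    (hw₁ : ∀ (y : Y₁) (g : G), ∑ x ∈ Finset.univ.filter (fun x => r₁ x = g • y), antiVec (Φ i₁) (1 : G) x =
      φ₁ (π g (e₁ y))) :
    typeRank G (sigmaType Φ) + Fintype.card I = (∑ i, typeRank G (Φ i)) + 1 := by
  have hcard : Fintype.card I = 2 := by
    rw [← Finset.card_univ, show (Finset.univ : Finset I) = {i₀, i₁} from Finset.ext fun j => by
      simpa only [Finset.mem_univ, Finset.mem_insert, Finset.mem_singleton, true_iff] using hI j,
      Finset.card_pair h01]
  have hpair := typeRank_add_typeRank_eq_add_finrank_shadowCoeff_inf_shadowCoeff_of_fine h hI h01 r₀ r₁ hr₀ hr₁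
    hfine₀ hfine₁
  have hS₀ : (Set.range fun y : Y₀ => fun g : G =>
      ∑ x ∈ Finset.univ.filter (fun x => r₀ x = g • y), antiVec (Φ i₀) (1 : G) x) =
        (fun v : V => fun g : G => φ₀ (π g v)) '' Set.range e₀ := by
    ext c
    simp only [Set.mem_range, Set.mem_image, exists_exists_eq_and]
    constructor
    · rintro ⟨y, rfl⟩
      exact ⟨y, funext fun g => (hw₀ y g).symm⟩
    · rintro ⟨y, rfl⟩
      exact ⟨y, funext fun g => hw₀ y g⟩
  have hS₁ : (Set.range fun y : Y₁ => fun g : G =>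
      ∑ x ∈ Finset.univ.filter (fun x => r₁ x = g • y), antiVec (Φ i₁) (1 : G) x) =
        (fun v : V => fun g : G => φ₁ (π g v)) '' Set.range e₁ := by
    ext c
    simp only [Set.mem_range, Set.mem_image, exists_exists_eq_and]
    constructor
    · rintro ⟨y, rfl⟩
      exact ⟨y, funext fun g => (hw₁ y g).symm⟩
    · rintro ⟨y, rfl⟩
      exact ⟨y, funext fun g => hw₁ y g⟩
  rw [hS₀, hS₁, span_inf_span_eq_bot_of_forall_intertwiningMap_ne π hne, finrank_bot, add_zero] at hpair
  rw [sum_eq_add_of_pair _ hI h01, hcard]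
  omega

end Summit.HodgeConjecture.CorCM.IrrOdd

end
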